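/-
Copyright: derived here (Resolution Observatory cell `pub-rosobs`, carver gen 58). AI-written Lean; AI review is weaker than expert
review.  Engine 1's THEOREM B′ (THEOREM-LT-eng1-g38 §9, "boundary weights") for the cell's POLYNOMIAL weighted-centre model `W(f)`, typed
as PURE LOGIC over the bootstrap frame of `WeightedCentreBootstrap`: BOOTSTRAP⁺'s induction run AT the boundary degree `ρ₁`.
Instrument — NOT a resolution theorem and NOT a statement about the invariant of [AbramovichTemkinWlodarczyk2024]; no algebra is done here.
-/
import Literature.AlgebraicGeometry.Resolution.WeightedCentreBootstrap
import HarnessLib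

/-!
# THEOREM B′ over the bootstrap frame: the induction AT the boundary degree (pure logic)

Uniform value line: INSTRUMENT — the structure-level implication of engine 1's THEOREM B′ (THEOREM-LT-eng1-g38 §9: "if `(N, w, g)` carries
a `(P)`-system of degree exactly `ρ₁ = 1/(p(p+1))`, then `N` contains slots of weight exactly `1/p` and `1/(p+1)` and, in suitable graded
coordinates, `g` contains a pure `p`-th power `c·ε_{f₀}^p` of a slot of weight `1/p`") in the cell's polynomial weighted-centre model `W(f)`,
over the abstract `SystemFrame` of `WeightedCentreBootstrap`; NOT a resolution theorem, NOT a statement about the Abramovich–Temkin–Włodarczyk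
invariant, NOT summit progress, and NOT a proof of the algebraic inputs (THEOREM R, PROPOSITION B, ABSORBER with heredity, (KILL) with
heredity, finiteness of `j*`), which enter as NAMED HYPOTHESES; AI-written Lean, AI review is weaker than expert review.

## Dictionary (THEOREM-LT §9, proof of THEOREM B′ ↔ this file)

The conclusion "`N` has slots of weights `1/p`, `1/(p+1)` and a Frobenius monomial on the former in suitable graded coordinates" is an
abstract predicate `Good : F.Conf → Prop`.  Its HEREDITY ("in cases (i), (iii) the two weights and the monomial are found in `N′ ⊂ N`
resp. `N ∖ D ⊂ N`, in graded coordinates of the subsystem extended by the identity") is carried by the laws themselves: ABSORBER and (KILL)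
return the smaller configuration `C'` together with `Good C' → Good C`.

* `SystemFrame.BLaws F ρ₁ Good`: `absorber` (T9 ABSORBER THEOREM, output on `N′ ⊊ N` with inherited weights, degree `≥`, heredity),
  `reduce_or_R0` (T9 (KILL) / FQ §7: either (R0) or a `(P)`-system of the same degree on `N ∖ D ⊊ N`, heredity), `finite_lightExp`
  (finitely many `j*` at a degree), `degLe` (THEOREM R: no `(P)`-system above `ρ₁` — e.g. `theoremR` of `WeightedCentreTheoremRFrame`),
  `propB` (PROPOSITION B: a degree-`ρ₁` `(P)`-system with a pure term and (H1), (H>), (Hmax), (R0) makes the configuration `Good`).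
* **`theoremBPrime`**: `BLaws F ρ₁ Good` ⇒ every configuration carrying a `(P)`-system of degree exactly `ρ₁` is `Good` — by strong induction
  on `size`, steps (i)–(iv) of loc. cit. verbatim: (i) a pure-free isotropy of degree `ρ₁` ⇒ ABSORBER ⇒ degree `≥ ρ₁` hence `= ρ₁` (`degLe`)
  on fewer slots ⇒ induction + heredity; (ii) otherwise (H1) at `ρ₁` and (H>) at `ρ₁` (`degLe`; isotropies of degree `≤ η < ρ₁` are harmless),
  choose `Φ` of degree `ρ₁` with `j*` maximal (`finite_lightExp`): (Hmax); (iii)/(iv) `reduce_or_R0`: a smaller system ⇒ induction + heredity,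
  (R0) ⇒ `propB`.
* `good_of_pinned` (COROLLARY shape: a pinned configuration with an isotropy of degree exactly `ρ₁ > η` is `Good`), `deg_lt_or_good`
  (the dichotomy `deg < ρ₁` or `deg = ρ₁ ∧ Good`), `BLaws.of_laws` (instantiation from `LawsPlus` + hereditary ABSORBER/(KILL) + a degree bound).

Where `p`, `q`, `1/p`, `1/(p+1)` enter: only inside `Good`, `degLe`, `propB`; the frame sees a rational `ρ₁`.  NOT here: PROPOSITION B itself
(`WeightedCentreBoundaryArith` = its `ℚ`-skeleton, `WeightedCentreFrobeniusPin` = its step (3)), THEOREM B″ (`WeightedCentreTwoClassArith`).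

References: context [AbramovichTemkinWlodarczyk2024] Thm. 5.3.1 (2)–(3) (graded automorphisms of the graded algebra of a weighted centre);
statements ours, elementary logic.
-/

namespace Literature.AlgebraicGeometry.Resolution.WeightedBlowup

namespace SystemFrame

universe u

variable (F : SystemFrame.{u})

/-- The inputs of THEOREM B′ (THEOREM-LT-eng1-g38 §9; ours) at the boundary degree `ρ₁`, over an abstract conclusion `Good` with heredity
built into ABSORBER and (KILL). [cite: AbramovichTemkinWlodarczyk2024, Thm. 5.3.1 (2)–(3) (p. 1578)] -/
structure BLaws (ρ₁ : ℚ) (Good : F.Conf → Prop) : Prop where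
  /-- ABSORBER THEOREM with heredity: a purely impure `(P)`-system yields one on fewer slots, of degree `≥`, and `Good` ascends. -/
  absorber : ∀ (η : ℚ) {C : F.Conf} (X : F.Iso C), F.PSystem η X → ¬ F.HasPure X →
    ∃ (C' : F.Conf) (X' : F.Iso C'), F.size C' < F.size C ∧ F.PSystem η X' ∧ F.deg X ≤ F.deg X' ∧ (Good C' → Good C)
  /-- (KILL) with heredity: either (R0), or a `(P)`-system of the same degree on fewer slots along which `Good` ascends. -/
  reduce_or_R0 : ∀ (η : ℚ) {C : F.Conf} (X : F.Iso C), F.PSystem η X → F.HasPure X →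
    F.R0 X ∨ ∃ (C' : F.Conf) (X' : F.Iso C'), F.size C' < F.size C ∧ F.PSystem η X' ∧ F.deg X' = F.deg X ∧ (Good C' → Good C)
  /-- at a fixed degree only finitely many lightest pure exponents occur -/
  finite_lightExp : ∀ (C : F.Conf) (ρ : ℚ),
    Set.Finite {j : ℕ | ∃ Y : F.Iso C, F.deg Y = ρ ∧ F.HasPure Y ∧ F.lightExp Y = j}
  /-- THEOREM R: no `(P)`-system has degree `> ρ₁`. -/
  degLe : ∀ (η : ℚ) {C : F.Conf} (X : F.Iso C), F.PSystem η X → F.deg X ≤ ρ₁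
  /-- PROPOSITION B (terminal case): a degree-`ρ₁` `(P)`-system with a pure term and (H1), (H>), (Hmax), (R0) makes `C` good. -/
  propB : ∀ (η : ℚ) {C : F.Conf} (X : F.Iso C), F.PSystem η X → F.deg X = ρ₁ → F.HasPure X →
    F.H1 C ρ₁ → F.Hgt C ρ₁ → F.Hmax X → F.R0 X → Good C

variable {F}

/-- **THEOREM B′ over the frame** (THEOREM-LT-eng1-g38 §9; ours): under `BLaws F ρ₁ Good`, every configuration carrying a `(P)`-system (any
threshold) of degree exactly `ρ₁` is `Good`.  Strong induction on `size`, steps (i)–(iv) of loc. cit.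
[cite: AbramovichTemkinWlodarczyk2024, Thm. 5.3.1 (2)–(3) (p. 1578)] -/
theorem theoremBPrime {ρ₁ : ℚ} {Good : F.Conf → Prop} (L : F.BLaws ρ₁ Good) :
    ∀ (η : ℚ) (C : F.Conf) (X : F.Iso C), F.PSystem η X → F.deg X = ρ₁ → Good C := by
  suffices h : ∀ (n : ℕ) (C : F.Conf), F.size C = n →
      ∀ (η : ℚ) (X : F.Iso C), F.PSystem η X → F.deg X = ρ₁ → Good C from
    fun η C X hX hdeg => h _ C rfl η X hX hdeg
  intro n
  induction n using Nat.strong_induction_on with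
  | _ n ih =>
    intro C hC η X₀ hX₀ hdeg₀
    have hηρ : η < ρ₁ := hdeg₀ ▸ hX₀.2
    -- (i) a pure-free isotropy of degree ρ₁: ABSORBER, degree ≥ ρ₁ hence = ρ₁ on fewer slots, induction, heredity
    by_cases hi : ∃ Y : F.Iso C, F.deg Y = ρ₁ ∧ ¬ F.HasPure Y
    · obtain ⟨Y, hY, hp⟩ := hi
      obtain ⟨C', X', hlt, hsys', hle, hgood⟩ := L.absorber η Y ⟨hX₀.1, hY ▸ hηρ⟩ hp
      exact hgood (ih _ (hC ▸ hlt) C' rfl η X' hsys' (le_antisymm (L.degLe η X' hsys') (hY ▸ hle)))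
    -- (ii) every isotropy of degree ρ₁ has a pure term: (H1) at ρ₁, (H>) at ρ₁
    have hpure : ∀ Y : F.Iso C, F.deg Y = ρ₁ → F.HasPure Y := by
      intro Y hY
      by_contra hp
      exact hi ⟨Y, hY, hp⟩
    have hHgt : F.Hgt C ρ₁ := by
      intro Y
      by_contra hle
      have hlt : ρ₁ < F.deg Y := lt_of_not_ge hle
      exact absurd (L.degLe η Y ⟨hX₀.1, lt_trans hηρ hlt⟩) hle
    have hH1 : F.H1 C ρ₁ := fun Y hY => hpure Y (le_antisymm (hHgt Y) hY)
    -- choose Φ of degree ρ₁ with j* maximal: (Hmax)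
    set J : Set ℕ := {j : ℕ | ∃ Y : F.Iso C, F.deg Y = ρ₁ ∧ F.HasPure Y ∧ F.lightExp Y = j} with hJ
    have hJfin : J.Finite := L.finite_lightExp C ρ₁
    have hJne : J.Nonempty := ⟨F.lightExp X₀, X₀, hdeg₀, hpure X₀ hdeg₀, rfl⟩
    obtain ⟨j₀, hj₀J, hj₀max⟩ := Set.exists_max_image J id hJfin hJne
    obtain ⟨Φ, hΦdeg, hΦpure, hΦj⟩ := hj₀J
    have hHmax : F.Hmax Φ := by
      intro Y hY
      rw [hΦdeg] at hY
      refine ⟨hpure Y hY, ?_⟩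
      rw [hΦj]
      exact hj₀max _ ⟨Y, hY, hpure Y hY, rfl⟩
    have hΦsys : F.PSystem η Φ := ⟨hX₀.1, hΦdeg ▸ hηρ⟩
    -- (iii) (KILL): a smaller degree-ρ₁ system ⇒ induction + heredity; (iv) (R0) ⇒ PROPOSITION B
    rcases L.reduce_or_R0 η Φ hΦsys hΦpure with hR0 | ⟨C', X', hlt, hsys', heq, hgood⟩
    · exact L.propB η Φ hΦsys hΦdeg hΦpure hH1 hHgt hHmax hR0
    · exact hgood (ih _ (hC ▸ hlt) C' rfl η X' hsys' (heq.trans hΦdeg))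

/-- The COROLLARY shape (ours): with `(P)` of threshold `η < ρ₁` on `C`, every non-trivial graded isotropy of degree exactly `ρ₁` forces
`Good C` — in the model: every bent maximal centre of the sharp rate `θ = 1/(p(p+1))` has `y`-slots of weights exactly `1/p` and `1/(p+1)`
and a Frobenius monomial on the former. [cite: AbramovichTemkinWlodarczyk2024, Thm. 5.3.1 (2)–(3) (p. 1578)] -/
theorem good_of_pinned {ρ₁ : ℚ} {Good : F.Conf → Prop} (L : F.BLaws ρ₁ Good) {η : ℚ} {C : F.Conf} (hC : F.Pinned η C)
    (hη : η < ρ₁) (X : F.Iso C) (hX : F.deg X = ρ₁) : Good C :=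
  theoremBPrime L η C X ⟨hC, hX ▸ hη⟩ hX

/-- Under `BLaws`, the degrees of `(P)`-systems are `≤ ρ₁` and the value `ρ₁` is attained only on `Good` configurations: the dichotomy
"`deg X < ρ₁`, or `deg X = ρ₁` and `Good C`" (ours, bookkeeping). [cite: AbramovichTemkinWlodarczyk2024, Thm. 5.3.1 (2)–(3) (p. 1578)] -/
theorem deg_lt_or_good {ρ₁ : ℚ} {Good : F.Conf → Prop} (L : F.BLaws ρ₁ Good) (η : ℚ) (C : F.Conf) (X : F.Iso C)
    (hX : F.PSystem η X) : F.deg X < ρ₁ ∨ (F.deg X = ρ₁ ∧ Good C) := by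
  rcases (L.degLe η X hX).lt_or_eq with h | h
  · exact Or.inl h
  · exact Or.inr ⟨h, theoremBPrime L η C X hX h⟩

/-- `BLaws` from `LawsPlus`-style data (ours, bookkeeping): if ABSORBER and (KILL) are given in the hereditary form and THEOREM R as a degree
bound, the remaining fields are those of `LawsPlus`. This packages the typical instantiation `degLe := theoremR …` of
`WeightedCentreTheoremRFrame`. [cite: AbramovichTemkinWlodarczyk2024, Thm. 5.3.1 (2)–(3) (p. 1578)] -/
theorem BLaws.of_laws {ρ₁ : ℚ} {Good : F.Conf → Prop} (L : F.LawsPlus)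
    (absorber : ∀ (η : ℚ) {C : F.Conf} (X : F.Iso C), F.PSystem η X → ¬ F.HasPure X →
      ∃ (C' : F.Conf) (X' : F.Iso C'), F.size C' < F.size C ∧ F.PSystem η X' ∧ F.deg X ≤ F.deg X' ∧ (Good C' → Good C))
    (reduce_or_R0 : ∀ (η : ℚ) {C : F.Conf} (X : F.Iso C), F.PSystem η X → F.HasPure X →
      F.R0 X ∨ ∃ (C' : F.Conf) (X' : F.Iso C'), F.size C' < F.size C ∧ F.PSystem η X' ∧ F.deg X' = F.deg X ∧ (Good C' → Good C))
    (degLe : ∀ (η : ℚ) {C : F.Conf} (X : F.Iso C), F.PSystem η X → ¬ ρ₁ < F.deg X)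
    (propB : ∀ (η : ℚ) {C : F.Conf} (X : F.Iso C), F.PSystem η X → F.deg X = ρ₁ → F.HasPure X →
      F.H1 C ρ₁ → F.Hgt C ρ₁ → F.Hmax X → F.R0 X → Good C) : F.BLaws ρ₁ Good :=
  ⟨absorber, reduce_or_R0, L.finite_lightExp, fun η _ X hX => le_of_not_gt (degLe η X hX), propB⟩

end SystemFrame

end Literature.AlgebraicGeometry.Resolution.WeightedBlowup
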